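import Summits.QuantumFields.BalabanUV.Beta.GAN24.WSlotSourceZeroModeZfree
import Summits.QuantumFields.BalabanUV.Beta.GAN24.ResponseExchangeStep
import Summits.QuantumFields.BalabanUV.Beta.GAN24.T2RecSourceRowsUndressed

/-!
# `BalabanUV.Beta.GAN24.SourceBracketChannelCharge` — binder row G-an2-4 ∕ (CONV-C), W-slot CT-W, route «WC-TL» (A-0 END
# `T2DevConservationEnd.t2Shape_T2RecAt_three_of_U_C_H`, row (U) = `T2UndressedCombShapeEnd.t2Shape_undressedComb_three_of_F2a` ✓ MODULO F2a-comb):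
# **THE ff CELL CHARGE OF THE SECOND-ORDER SOURCE BRACKET IS THE STEP KERNEL's SQUARED LEG CHARGE TIMES FOUR CHANNEL BOND SUMS — VALUE FORM**
# (road W3's Part B `WSlotSourceZeroModeStep.inner_value_unitKStep_eq_zero` with the four `HasSum … 0` hypotheses replaced by `HasSum … eᵢ`,
# `HasSum … rᵢ` for ARBITRARY values), hence **F2a-comb's charge conjunct at level `j` ⟸ ONE scalar CELL identity among the four channel sums of
# the recursive tables `(unitS_j (SpureRecAt ρ … j), unitM_j (M1At ρ cΛ j))`** — pointwise vanishing (road W3's Stage-B mechanism, (S3c)) is NOT needed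

NOT IN PRINT; OUR BOOKKEEPING ([folklore] re-assembly of road W3's Part A∕B BY NAME with values threaded; G-an2-4 formalisation swarm, leaf prover
`b2b-balaban-gan24-formalise-leaf-04`, gen 60; name PROVISIONAL — the OWNER gan24-p1 may rename ∕ re-cut).  HONEST FRAMING (cell contract, verbatim):
«discharging `BetaPertH` makes Bałaban's UV stability UNCONDITIONAL — a real constructive-QFT result; it is NOT the continuum limit and NOT the Clay
problem.»  HONEST DEPENDENCY (verbatim): «continuum YM on T⁴ ⇐ BetaPertH ∧ nine spine estimates (0/9 proved); BetaPertH ⇐ (D1) ∧ (D4) ∧ CAP+tail;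
G-an2-4 gates asym, D1 and NE2/3/4.»

WHY.  F2a-comb (`ZfreeSym` of the sources `b^B_j` of the undressed-kernel comb-slot reference tower) is the ONE letter left on the (U) side of WC-TL's A-0 row
(leaf-04's (B) p314162 ✓, (U-drift) p316409 ✓, junction p316684 ✓ — all MODULO F2a-comb; refuter v3.30 QW9 «INDICATED ✓ m = 0, 1 — typer unnamed»).  Road W3's
plug (`WSlotSourceZeroModeHolds`, Stage-B `Spure`∕`M1`) runs on the four (S3c)-channel bond sums vanishing POINTWISE in the first bond `(κ, u)`; gan24-p2 g36 located
(journal l.38118 (c), l.38326 W-15a) that (S3c)(i) FAILS pointwise for `unitS (SpureRecAt ρ 1)` while the CELL charge vanishes numerically (the OWNER's R4∕R4b,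
D = 2: `Z(b^B_1) = 2.5e-6 ∕ −7.9e-7` on scale `4e8`).  `zmode` sums the first bond over a period cell, so only CELL-SUMMED channel data can matter — made precise here.

WHAT ([folklore]; generic `d`, `[NeZero Lc]`, every `j`, all units `sf sm`, generic first tables `S` (`LocStencil`), `M` (`VertexFamily`) and jointly block-covariant
`LocStencilFM` mixed table `M₂`; the step kernel `K♮_j = unitK sf sm (KInvStep Lc j)`, `σ_j := ((Lc^{j+1})^{d+2})⁻¹` its site-free coarse-leg charge scale
(`StepResolventLegCharges.hasSum_unitK_row∕col`); 0 `def`, 0 cited facts, 0 `def … : Prop`, 0 sorry):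
* §1 **`sandwich_transfer_value`** (Part A's `sandwich_transfer` with an arbitrary bond-series value `s`: the sandwiched `mm`-read pair sums have bond series
  `HasSum` to `−(sL·sR)·s`) and **`inner_eq_of_hasSum_pair`** (value form of the pair → triple-sum bridge).
* §2 **`inner_value_unitKStep_eq`** — VALUE FORM of Part B §6: if the two exchange-tree middles and the two second-response halves have ff double-leg bond series with
  sums `e₁, e₂, r₁, r₂` at the first bond `(κ, u)`, then `Σ'_{u′} Σ'_x Σ'_z mmRead Lc (K3OfK K♮_j Lc S M (W2SymOfK K♮_j Lc S M 0 M₂) κ u κ′ u′) x z (inl α) (inl β)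
  = −(s_f s_m σ_j)²·(e₁ + e₂ − (r₁ + r₂)∕2)`; the mixed channel drops by leaf-14's (S2c) reduction `MixedChannelBondSums.hasSum_tsum_prod_W2SymOfK_sub_resp_unitKStep`.
* §3 **`zmode_bracket_eq`** — CELL FORM (leaf-02's `BiStencilZeroMode.zmode`, any period `P`): the cell charge of the bracket `c • value + cB • vh₂S` at an ff-free
  border (`hBff`) is `c·(−(s_f s_m σ_j)²)·Σ_{r ∈ box P} (e₁ + e₂ − (r₁ + r₂)∕2)(toSite r)`.
* §4 **`zmodeSym_comb_bracket_eq_zero_of_cell`** — at the comb-slot reference tower's literal level-`j` data `(unitS_j (SpureRecAt d Lc (toSite r) cE cVH cΛ j),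
  unitM_j (M1At d Lc (toSite r) cΛ j), unitM₂_j (M2Of d Lc (mixFFAt (toSite r) Lc) j))` (shapes by an2's `locStencil_SpureRecAt` ∕ `vertexFamily_M1At`, an1's
  `hmix_an1` ∕ `hmixt_an1`, leaf-07's `WSlotOfShapes`), any box root, any border with `hBff`: the SYMMETRISED `Lc`-cell charge of `b^B_j` (F2a-comb's second
  conjunct, road W3's `ZfreeSym` currency) VANISHES as soon as `Σ_{r ∈ box Lc} [q(κ, toSite r, κ′) + q(κ′, toSite r, κ)] = 0`, `q := e₁ + e₂ − (r₁ + r₂)∕2` —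
  **F2a-comb_j (charge conjunct) ⟸ ONE scalar symmetrised CELL channel identity per `(κ, κ′, α, β)`**: the located content of the open letter.
HONEST: [folklore] bookkeeping; the cell channel identity is a HYPOTHESIS here (its supplier — a cell-level Ward cancellation for the recursive first-order
tables — is UNLOCATED; for Stage-B `Spure` it is road W3's pointwise (S3c)); asserts NO value of Bałaban's tables; discharges NOTHING of F2a-comb ∕ (U) ∕ (C) ∕
«T2Shape» ∕ «T2Drift» ∕ (hW, hWall); NEVER «G-an2-4 closed» as (CONV-C); NOT D1, NOT `BetaPertH`, NOT continuum, NOT Clay.  2026-08-22.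
-/

noncomputable section

open Finset
open scoped BigOperators
open Literature.MathematicalPhysics.QuantumFieldTheory
open Literature.MathematicalPhysics.QuantumFieldTheory.Balaban1983to89
open Literature.MathematicalPhysics.QuantumFieldTheory.Balaban1983to89.Beta
open AffineAveraging (Site box toSite)
open ExpKernelCalculus (MKer Decays BiLoc VertexFamily comp shiftK)
open OneStepResolventKernel (Fib LocStencil)
open OneStepKernelFamily (KInvStep decays_KInvStep)
open SecondOrderResponse (dM K2OfK vertex2OfK mixOfK W2OfK W2SymOfK LocStencilFM)
open AveragingMixedJetTables (mixFFAt mixFFAt_inl_inr mixFFAt_inr)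
open BalabanStepW2 (K3OfK M2Of M2Of_translate)
open BalabanStepJetsSucc (mmRead mmRead_inl_inl)
open Summit.QuantumFields.BalabanUV.Beta.HessKerDressedUnits (unitK unitS decays_unitK locStencil_unitS)
open Summit.QuantumFields.BalabanUV.Beta.SecondOrderUnits (unitM unitM₂)
open Summit.QuantumFields.BalabanUV.Beta.SpineRooted (SpureRecAt M1At locStencil_SpureRecAt vertexFamily_M1At)
open Summit.QuantumFields.BalabanUV.Beta.MixedJetTablesPlug (hmix_an1 hmixt_an1)
open Summit.QuantumFields.BalabanUV.Beta.GAN24.CombesThomas (sfStep smStep)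
open Summit.QuantumFields.BalabanUV.Beta.TameKernelCalculus (Spr Loc Tame)
open Summit.QuantumFields.BalabanUV.Beta.GAN24.BiStencilZeroMode (Tab zmode)
open Summit.QuantumFields.BalabanUV.Beta.GAN24.ExchangeReadout (K3OfK_apply_eq)
open Summit.QuantumFields.BalabanUV.Beta.GAN24.WSlotSourceZeroMode (W2SymOfK_zero_eq inner_eq_tsum_pair)
open Summit.QuantumFields.BalabanUV.Beta.GAN24.WSlotOfShapes (locStencilFM_unitM₂_M2Of)
open Summit.QuantumFields.BalabanUV.Beta.GAN24.WSlotSourceZeroModeZfree (unitM₂_translate)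
open Summit.QuantumFields.BalabanUV.Beta.GAN24.ResponseExchangeStep (vertexFamily_unitM)

namespace Summit.QuantumFields.BalabanUV.Beta.GAN24.SourceBracketChannelCharge

variable {d : ℕ}

/-! ## §1 The sandwich transfer, value form -/

section Transfer

variable {N : ℕ} [NeZero N] {K : MKer (d + 1) (Fib d)} {C δ : ℝ}

/-- [folklore] **SANDWICH TRANSFER, VALUE FORM** (road W3 Part A's `WSlotSourceZeroMode.sandwich_transfer` with an arbitrary bond-series value `s`): for a decaying
`K` with SITE-FREE coarse-leg charges of the `Sum.elim` shape and a bond family of LOCALISED kernels `V u′` whose ff double-leg sums have a bond series with sum `s`, the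
sandwiched `mm`-read family is pair-summable at every bond and its bond series of pair sums has sum `−(sL·sR)·s` (leaf-06's `hasSum_sandwich_readout`, linearity). -/
theorem sandwich_transfer_value (hK : Decays K C δ) (hδ : 0 < δ) (α β : Fin (d + 1)) {sL sR : ℝ}
    (hrow : ∀ (f : Fib d) (y : Site (d + 1)), HasSum (fun x' : Site (d + 1) => K ((N : ℤ) • x') y (Sum.inr α) f)
      (Sum.elim (fun a => -(if a = α then sL else 0)) (fun _ => (0 : ℝ)) f))
    (hcol : ∀ (g : Fib d) (w : Site (d + 1)), HasSum (fun z' : Site (d + 1) => K w ((N : ℤ) • z') g (Sum.inr β))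
      (Sum.elim (fun b => if b = β then sR else 0) (fun _ => (0 : ℝ)) g))
    {V : Site (d + 1) → MKer (d + 1) (Fib d)} (hV : ∀ u', Loc (V u')) {s : ℝ}
    (hVs : HasSum (fun u' : Site (d + 1) => ∑' yw : Site (d + 1) × Site (d + 1), V u' yw.1 yw.2 (Sum.inl α) (Sum.inl β)) s) :
    (∀ u', Summable fun xz : Site (d + 1) × Site (d + 1) =>
        mmRead N (comp (comp K (V u')) K) xz.1 xz.2 (Sum.inl α) (Sum.inl β)) ∧
      HasSum (fun u' : Site (d + 1) => ∑' xz : Site (d + 1) × Site (d + 1),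
        mmRead N (comp (comp K (V u')) K) xz.1 xz.2 (Sum.inl α) (Sum.inl β)) (-(sL * sR) * s) := by
  -- the read-out of each member (verbatim from road W3 Part A)
  have hR : ∀ u', HasSum (fun xz : Site (d + 1) × Site (d + 1) =>
        mmRead N (comp (comp K (V u')) K) xz.1 xz.2 (Sum.inl α) (Sum.inl β))
      (-(sL * sR) * ∑' yw : Site (d + 1) × Site (d + 1), V u' yw.1 yw.2 (Sum.inl α) (Sum.inl β)) := by
    intro u'
    obtain ⟨p, q, Cv, δv, hδv, hVb⟩ := hV u'
    have h := ResolventLegCharges.hasSum_sandwich_readout (N := N) hK hδ hVb hδv α β hrow hcol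
    simp_rw [StepResolventLegCharges.sum_elim_charges] at h
    rw [tsum_mul_left] at h
    simpa only [mmRead_inl_inl] using h
  refine ⟨fun u' => (hR u').summable, ?_⟩
  exact (hVs.mul_left (-(sL * sR))).congr_fun fun u' => (hR u').tsum_eq

end Transfer


/-- [folklore] Value form of road W3 Part A's `WSlotSourceZeroMode.inner_eq_zero_of_hasSum_pair`: per-bond pair summability and
`HasSum (u′ ↦ Σ'_{(x,z)} F u′ x z) a` give `Σ'_{u′} Σ'_x Σ'_z F u′ x z = a`. -/
theorem inner_eq_of_hasSum_pair {F : Site (d + 1) → Site (d + 1) → Site (d + 1) → ℝ}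
    (hp : ∀ u', Summable fun xz : Site (d + 1) × Site (d + 1) => F u' xz.1 xz.2) {a : ℝ}
    (hz : HasSum (fun u' => ∑' xz : Site (d + 1) × Site (d + 1), F u' xz.1 xz.2) a) :
    (∑' u', ∑' x, ∑' z, F u' x z) = a := by
  rw [inner_eq_tsum_pair hp]
  exact hz.tsum_eq

/-! ## §2 The value part's transversal inner sum through the step kernel, value form -/

section Step

variable {Lc : ℕ} [NeZero Lc] (sf sm : ℝ) (j : ℕ)
  {S M : Fin (d + 1) → Site (d + 1) → MKer (d + 1) (Fib d)} {Cs δs CM δM : ℝ}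
  {M₂ : Fin (d + 1) → Site (d + 1) → Fin (d + 1) → Site (d + 1) → MKer (d + 1) (Fib d)} {C₂ δ₂ : ℝ}

/-- NOT IN PRINT; OUR BOOKKEEPING ([folklore]; road W3 Part B §6 `WSlotSourceZeroModeStep.inner_value_unitKStep_eq_zero` with VALUES threaded — same route:
`K3OfK_apply_eq` + `exchange_eq_sandwich`, the `W`-term's bond sum is half the two second-response halves' (leaf-14's (S2c) reduction), §1 for the three sandwiches).
**THE VALUE PART's TRANSVERSAL ff INNER SUM = −(s_f s_m σ_j)²·(e₁ + e₂ − (r₁ + r₂)∕2)** for the step kernel `K♮_j = unitK s_f s_m (KInvStep Lc j)`, first tables `S`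
(`LocStencil`), `M` (`VertexFamily` at blocking `Lc`), a jointly block-covariant `LocStencilFM` mixed table `M₂`, every first bond `(κ, u)`, second direction `κ′`, field
pair `(α, β)`, IF the ff double-leg bond series (over `u′`) of the exchange-tree middles `(dM_{(κ,u)} ∘ K♮_j) ∘ dM_{(κ′,u′)}`, `(dM_{(κ′,u′)} ∘ K♮_j) ∘ dM_{(κ,u)}` and of
the second-response halves `dM (K2OfK … (κ′,u′)) … (κ,u)`, `dM (K2OfK … (κ,u)) … (κ′,u′)` have sums `e₁, e₂, r₁, r₂` (road W3's §6 is `e₁ = e₂ = r₁ = r₂ = 0`). -/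
theorem inner_value_unitKStep_eq (hS : LocStencil S Cs δs) (hδs : 0 < δs) (hM : VertexFamily M Lc CM δM) (hδM : 0 < δM)
    (hM₂ : LocStencilFM Lc M₂ C₂ δ₂) (hδ₂ : 0 < δ₂)
    (hM₂t : ∀ (κ : Fin (d + 1)) (u : Site (d + 1)) (ρ : Fin (d + 1)) (w t : Site (d + 1)),
      M₂ κ (u + (Lc : ℤ) • t) ρ (w + t) = shiftK (-((Lc : ℤ) • t)) (M₂ κ u ρ w))
    (κ : Fin (d + 1)) (u : Site (d + 1)) (κ' α β : Fin (d + 1)) {e₁ e₂ r₁ r₂ : ℝ}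
    (hE₁ : HasSum (fun u' : Site (d + 1) => ∑' yw : Site (d + 1) × Site (d + 1),
      comp (comp (dM (unitK sf sm (KInvStep (d := d) Lc j)) Lc S M κ u) (unitK sf sm (KInvStep (d := d) Lc j)))
        (dM (unitK sf sm (KInvStep (d := d) Lc j)) Lc S M κ' u') yw.1 yw.2 (Sum.inl α) (Sum.inl β)) e₁)
    (hE₂ : HasSum (fun u' : Site (d + 1) => ∑' yw : Site (d + 1) × Site (d + 1),
      comp (comp (dM (unitK sf sm (KInvStep (d := d) Lc j)) Lc S M κ' u') (unitK sf sm (KInvStep (d := d) Lc j)))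
        (dM (unitK sf sm (KInvStep (d := d) Lc j)) Lc S M κ u) yw.1 yw.2 (Sum.inl α) (Sum.inl β)) e₂)
    (hR₁ : HasSum (fun u' : Site (d + 1) => ∑' yw : Site (d + 1) × Site (d + 1),
      dM (K2OfK (unitK sf sm (KInvStep (d := d) Lc j)) Lc S M κ' u') Lc S M κ u yw.1 yw.2 (Sum.inl α) (Sum.inl β)) r₁)
    (hR₂ : HasSum (fun u' : Site (d + 1) => ∑' yw : Site (d + 1) × Site (d + 1),
      dM (K2OfK (unitK sf sm (KInvStep (d := d) Lc j)) Lc S M κ u) Lc S M κ' u' yw.1 yw.2 (Sum.inl α) (Sum.inl β)) r₂) :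
    (∑' u', ∑' x, ∑' z, mmRead Lc (K3OfK (unitK sf sm (KInvStep (d := d) Lc j)) Lc S M
      (W2SymOfK (unitK sf sm (KInvStep (d := d) Lc j)) Lc S M 0 M₂) κ u κ' u') x z (Sum.inl α) (Sum.inl β))
      = -((sf * sm * ((((Lc ^ (j + 1) : ℕ) : ℝ)) ^ (d + 1 + 1))⁻¹) ^ 2) * (e₁ + e₂ - (r₁ + r₂) / 2) := by
  -- the step kernel: decay, spread, site-free charges (verbatim from road W3 Part B §6)
  obtain ⟨δ, C, hδ, hC, hK⟩ := decays_KInvStep (d := d) (Lc := Lc) j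
  have hKu : Decays (unitK sf sm (KInvStep (d := d) Lc j)) (max |sf| |sm| * C * max |sf| |sm|) δ := decays_unitK hK
  have hCu : 0 ≤ max |sf| |sm| * C * max |sf| |sm| := hKu.nonneg (Sum.inl 0)
  have hSpr : Spr (unitK sf sm (KInvStep (d := d) Lc j)) := ⟨_, _, hδ, hKu⟩
  have hrow : ∀ (f : Fib d) (w : Site (d + 1)), HasSum (fun x' : Site (d + 1) =>
      unitK sf sm (KInvStep (d := d) Lc j) (((Lc : ℕ) : ℤ) • x') w (Sum.inr α) f)
      (Sum.elim (fun a => -(if a = α then sm * ((((Lc ^ (j + 1) : ℕ) : ℝ)) ^ (d + 1 + 1))⁻¹ * sf else 0)) (fun _ => (0 : ℝ)) f) := by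
    intro f w
    have h := StepResolventLegCharges.hasSum_unitK_row sf sm (StepResolventLegCharges.hasSum_KInvStep_row (d := d) (Lc := Lc) j α f w)
    rcases f with a | m
    · simp only [Sum.elim_inl, HessKerDressedUnits.legScale_inl] at h ⊢
      convert h using 1
      split_ifs <;> ring
    · simp only [Sum.elim_inr, HessKerDressedUnits.legScale_inr, mul_zero, zero_mul] at h ⊢
      exact h
  have hcol : ∀ (g : Fib d) (w : Site (d + 1)), HasSum (fun z' : Site (d + 1) =>
      unitK sf sm (KInvStep (d := d) Lc j) w (((Lc : ℕ) : ℤ) • z') g (Sum.inr β))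
      (Sum.elim (fun b => if b = β then sf * ((((Lc ^ (j + 1) : ℕ) : ℝ)) ^ (d + 1 + 1))⁻¹ * sm else 0) (fun _ => (0 : ℝ)) g) := by
    intro g w
    have h := StepResolventLegCharges.hasSum_unitK_col sf sm (StepResolventLegCharges.hasSum_KInvStep_col (d := d) (Lc := Lc) j β g w)
    rcases g with b | m
    · simp only [Sum.elim_inl, HessKerDressedUnits.legScale_inl] at h ⊢
      convert h using 1
      split_ifs <;> ring
    · simp only [Sum.elim_inr, HessKerDressedUnits.legScale_inr, mul_zero, zero_mul] at h ⊢
      exact h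
  have lb : ∀ (μ : Fin (d + 1)) (y : Site (d + 1)), Loc (dM (unitK sf sm (KInvStep (d := d) Lc j)) Lc S M μ y) :=
    fun μ y => ExchangeReadout.loc_dM (N := Lc) hKu hδ hS hδs hM hδM μ y
  set m : ℝ := min (min (min δ δs) δM) δ₂ with hm_def
  have hm : 0 < m := lt_min (lt_min (lt_min hδ hδs) hδM) hδ₂
  have hm2 : m ≤ δ₂ := min_le_right _ _
  have hmM : m ≤ δM := (min_le_left _ _).trans (min_le_right _ _)
  have hms : m ≤ δs := (min_le_left _ _).trans ((min_le_left _ _).trans (min_le_right _ _))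
  have hmK : m ≤ δ := (min_le_left _ _).trans ((min_le_left _ _).trans (min_le_left _ _))
  have hCs : 0 ≤ Cs := (hS 0 0).nonneg (Sum.inl 0)
  have hCM : 0 ≤ CM := (hM 0 0).nonneg (Sum.inl 0)
  have hKm : Decays (unitK sf sm (KInvStep (d := d) Lc j)) (max |sf| |sm| * C * max |sf| |sm|) m :=
    OneStepResolventKernel.decays_mono hKu hCu le_rfl hmK
  have hSm : LocStencil S Cs m := BalabanStepJets.locStencil_mono hS hCs hms
  have hMm : VertexFamily M Lc CM m := fun μ y => OneStepResolventKernel.biLoc_mono (hM μ y) hCM hmM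
  have hM₂m : LocStencilFM Lc M₂ C₂ m := hM₂.mono hm2
  have hmixF := SecondOrderResponse.vertexFamily₂_mixOfK (N := Lc) hKm hCu hM₂m hm
  have hm8 : 0 < m / 8 := by positivity
  have lmix : ∀ (μ : Fin (d + 1)) (y : Site (d + 1)) (ν : Fin (d + 1)) (y' : Site (d + 1)),
      Loc (mixOfK (unitK sf sm (KInvStep (d := d) Lc j)) Lc M₂ μ y ν y') :=
    fun μ y ν y' => ⟨_, _, _, _, hm8, hmixF μ y ν y'⟩
  have hK2 := SecondOrderResponse.vertexFamily_K2OfK (N := Lc) hKm hCu hm hSm hMm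
  have hS8 : LocStencil S Cs (m / 8) := BalabanStepJets.locStencil_mono hS hCs (by linarith)
  have hM8 : VertexFamily M Lc CM (m / 8) := fun μ y => OneStepResolventKernel.biLoc_mono (hM μ y) hCM (by linarith)
  have hrespF := SecondOrderResponse.vertexFamily₂_resp hK2 hS8 hM8 hm8
  have hm82 : 0 < m / 8 / 2 := by positivity
  have lresp : ∀ (μ : Fin (d + 1)) (y : Site (d + 1)) (ν : Fin (d + 1)) (y' : Site (d + 1)),
      Loc (dM (K2OfK (unitK sf sm (KInvStep (d := d) Lc j)) Lc S M ν y') Lc S M μ y) :=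
    fun μ y ν y' => ⟨_, _, _, _, hm82, hrespF μ y ν y'⟩
  have lW : ∀ (μ : Fin (d + 1)) (y : Site (d + 1)) (ν : Fin (d + 1)) (y' : Site (d + 1)),
      Loc (W2SymOfK (unitK sf sm (KInvStep (d := d) Lc j)) Lc S M 0 M₂ μ y ν y') := by
    intro μ y ν y'
    rw [W2SymOfK_zero_eq]
    exact (((lmix μ y ν y').add (lmix ν y' μ y)).add ((lresp μ y ν y').smul _)).add ((lresp ν y' μ y).smul _)
  -- the three sandwiched channels in the pair currency, WITH VALUES (§1)
  obtain ⟨pE₁, zE₁⟩ := sandwich_transfer_value (N := Lc) hKu hδ α β hrow hcol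
    (V := fun u' => comp (comp (dM (unitK sf sm (KInvStep (d := d) Lc j)) Lc S M κ u) (unitK sf sm (KInvStep (d := d) Lc j)))
      (dM (unitK sf sm (KInvStep (d := d) Lc j)) Lc S M κ' u'))
    (fun u' => ((lb κ u).comp_spr hSpr).comp (lb κ' u')) hE₁
  obtain ⟨pE₂, zE₂⟩ := sandwich_transfer_value (N := Lc) hKu hδ α β hrow hcol
    (V := fun u' => comp (comp (dM (unitK sf sm (KInvStep (d := d) Lc j)) Lc S M κ' u') (unitK sf sm (KInvStep (d := d) Lc j)))
      (dM (unitK sf sm (KInvStep (d := d) Lc j)) Lc S M κ u))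
    (fun u' => ((lb κ' u').comp_spr hSpr).comp (lb κ u)) hE₂
  -- the `W`-term: its ff double-leg bond sum is HALF the two second-response halves' (leaf-14, (S2c))
  have hWv : HasSum (fun u' : Site (d + 1) => ∑' yw : Site (d + 1) × Site (d + 1),
      W2SymOfK (unitK sf sm (KInvStep (d := d) Lc j)) Lc S M 0 M₂ κ u κ' u' yw.1 yw.2 (Sum.inl α) (Sum.inl β)) ((1 / 2 : ℝ) * (r₁ + r₂)) := by
    have h := MixedChannelBondSums.hasSum_tsum_prod_W2SymOfK_sub_resp_unitKStep sf sm j hS hδs hM hδM hM₂ hδ₂ hM₂t κ u κ'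
      (Sum.inl α) (Sum.inl β)
    have h2 := h.add ((hR₁.add hR₂).mul_left (1 / 2 : ℝ))
    rw [zero_add] at h2
    exact h2.congr_fun fun u' => by ring
  obtain ⟨pW, zW⟩ := sandwich_transfer_value (N := Lc) hKu hδ α β hrow hcol
    (V := fun u' => W2SymOfK (unitK sf sm (KInvStep (d := d) Lc j)) Lc S M 0 M₂ κ u κ' u') (fun u' => lW κ u κ' u') hWv
  have hv : ∀ u' x z, mmRead Lc (K3OfK (unitK sf sm (KInvStep (d := d) Lc j)) Lc S M
        (W2SymOfK (unitK sf sm (KInvStep (d := d) Lc j)) Lc S M 0 M₂) κ u κ' u') x z (Sum.inl α) (Sum.inl β) =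
      mmRead Lc (comp (comp (unitK sf sm (KInvStep (d := d) Lc j))
          (comp (comp (dM (unitK sf sm (KInvStep (d := d) Lc j)) Lc S M κ u) (unitK sf sm (KInvStep (d := d) Lc j)))
            (dM (unitK sf sm (KInvStep (d := d) Lc j)) Lc S M κ' u'))) (unitK sf sm (KInvStep (d := d) Lc j))) x z (Sum.inl α) (Sum.inl β)
      + mmRead Lc (comp (comp (unitK sf sm (KInvStep (d := d) Lc j))
          (comp (comp (dM (unitK sf sm (KInvStep (d := d) Lc j)) Lc S M κ' u') (unitK sf sm (KInvStep (d := d) Lc j)))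
            (dM (unitK sf sm (KInvStep (d := d) Lc j)) Lc S M κ u))) (unitK sf sm (KInvStep (d := d) Lc j))) x z (Sum.inl α) (Sum.inl β)
      - mmRead Lc (comp (comp (unitK sf sm (KInvStep (d := d) Lc j))
          (W2SymOfK (unitK sf sm (KInvStep (d := d) Lc j)) Lc S M 0 M₂ κ u κ' u')) (unitK sf sm (KInvStep (d := d) Lc j)))
            x z (Sum.inl α) (Sum.inl β) := by
    intro u' x z
    simp only [mmRead_inl_inl]
    rw [K3OfK_apply_eq, ExchangeReadout.exchange_eq_sandwich hSpr (lb κ u) (lb κ' u'),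
      ExchangeReadout.exchange_eq_sandwich hSpr (lb κ' u') (lb κ u)]
  have hpV : ∀ u', Summable fun xz : Site (d + 1) × Site (d + 1) =>
      mmRead Lc (K3OfK (unitK sf sm (KInvStep (d := d) Lc j)) Lc S M
        (W2SymOfK (unitK sf sm (KInvStep (d := d) Lc j)) Lc S M 0 M₂) κ u κ' u') xz.1 xz.2 (Sum.inl α) (Sum.inl β) := by
    intro u'
    refine (((pE₁ u').add (pE₂ u')).sub (pW u')).congr fun xz => ?_
    rw [hv u' xz.1 xz.2]
  have hzV : HasSum (fun u' => ∑' xz : Site (d + 1) × Site (d + 1),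
      mmRead Lc (K3OfK (unitK sf sm (KInvStep (d := d) Lc j)) Lc S M
        (W2SymOfK (unitK sf sm (KInvStep (d := d) Lc j)) Lc S M 0 M₂) κ u κ' u') xz.1 xz.2 (Sum.inl α) (Sum.inl β))
      (-(sm * ((((Lc ^ (j + 1) : ℕ) : ℝ)) ^ (d + 1 + 1))⁻¹ * sf * (sf * ((((Lc ^ (j + 1) : ℕ) : ℝ)) ^ (d + 1 + 1))⁻¹ * sm)) * e₁ + -(sm * ((((Lc ^ (j + 1) : ℕ) : ℝ)) ^ (d + 1 + 1))⁻¹ * sf * (sf * ((((Lc ^ (j + 1) : ℕ) : ℝ)) ^ (d + 1 + 1))⁻¹ * sm)) * e₂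
        - -(sm * ((((Lc ^ (j + 1) : ℕ) : ℝ)) ^ (d + 1 + 1))⁻¹ * sf * (sf * ((((Lc ^ (j + 1) : ℕ) : ℝ)) ^ (d + 1 + 1))⁻¹ * sm)) * ((1 / 2 : ℝ) * (r₁ + r₂))) := by
    have h := (zE₁.add zE₂).sub zW
    refine h.congr_fun fun u' => ?_
    rw [← (pE₁ u').tsum_add (pE₂ u'), ← ((pE₁ u').add (pE₂ u')).tsum_sub (pW u')]
    exact tsum_congr fun xz => hv u' xz.1 xz.2
  -- (expected type first: the pattern `?F u' x z` is solved from the stated triple sum, as in road W3's `exact`)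
  have key : (∑' u', ∑' x, ∑' z, mmRead Lc (K3OfK (unitK sf sm (KInvStep (d := d) Lc j)) Lc S M
      (W2SymOfK (unitK sf sm (KInvStep (d := d) Lc j)) Lc S M 0 M₂) κ u κ' u') x z (Sum.inl α) (Sum.inl β))
      = -(sm * ((((Lc ^ (j + 1) : ℕ) : ℝ)) ^ (d + 1 + 1))⁻¹ * sf * (sf * ((((Lc ^ (j + 1) : ℕ) : ℝ)) ^ (d + 1 + 1))⁻¹ * sm)) * e₁
        + -(sm * ((((Lc ^ (j + 1) : ℕ) : ℝ)) ^ (d + 1 + 1))⁻¹ * sf * (sf * ((((Lc ^ (j + 1) : ℕ) : ℝ)) ^ (d + 1 + 1))⁻¹ * sm)) * e₂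
        - -(sm * ((((Lc ^ (j + 1) : ℕ) : ℝ)) ^ (d + 1 + 1))⁻¹ * sf * (sf * ((((Lc ^ (j + 1) : ℕ) : ℝ)) ^ (d + 1 + 1))⁻¹ * sm)) * ((1 / 2 : ℝ) * (r₁ + r₂)) :=
    inner_eq_of_hasSum_pair hpV hzV
  rw [key]
  ring

end Step

/-! ## §3 The cell form: the bracket's ff cell charge is the scaled cell sum of the channel combination -/

section Cell

variable {Lc : ℕ} [NeZero Lc] (sf sm : ℝ) (j : ℕ)
  {S M : Fin (d + 1) → Site (d + 1) → MKer (d + 1) (Fib d)} {Cs δs CM δM : ℝ}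
  {M₂ : Fin (d + 1) → Site (d + 1) → Fin (d + 1) → Site (d + 1) → MKer (d + 1) (Fib d)} {C₂ δ₂ : ℝ}

/-- NOT IN PRINT; OUR BOOKKEEPING ([folklore]; §2 at every first bond of one period cell, `BiStencilZeroMode.zmode` unfolded; scalar and ff-FREE border by the
`TransversalZeroMode.inner_smul` pattern).  **CELL FORM — THE SOURCE BRACKET's ff CELL CHARGE**: for `b κ u κ′ u′ := c • (value part) κ u κ′ u′ + cB • vh₂S κ u κ′ u′`
(ANY scalar `c` — the tower's `cE₂·Lc^{2(d+1)}` —, any `cB`, a border with NO ff entries `hBff`) and channel bond-series sums `e₁ e₂ r₁ r₂ : Site → ℝ` (functions of the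
first bond position, at fixed `κ κ′ α β`): `zmode P b κ κ′ (inl α) (inl β) = c·(−(s_f s_m σ_j)²)·Σ_{r ∈ box P} (e₁ + e₂ − (r₁ + r₂)∕2)(toSite r)` for EVERY period `P`. -/
theorem zmode_bracket_eq (P : ℕ) (c cB : ℝ) {vh₂S : Tab d}
    (hBff : ∀ κ u κ' u' x z (α β : Fin (d + 1)), vh₂S κ u κ' u' x z (Sum.inl α) (Sum.inl β) = 0)
    (hS : LocStencil S Cs δs) (hδs : 0 < δs) (hM : VertexFamily M Lc CM δM) (hδM : 0 < δM)
    (hM₂ : LocStencilFM Lc M₂ C₂ δ₂) (hδ₂ : 0 < δ₂)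
    (hM₂t : ∀ (κ : Fin (d + 1)) (u : Site (d + 1)) (ρ : Fin (d + 1)) (w t : Site (d + 1)),
      M₂ κ (u + (Lc : ℤ) • t) ρ (w + t) = shiftK (-((Lc : ℤ) • t)) (M₂ κ u ρ w))
    (κ κ' α β : Fin (d + 1)) {e₁ e₂ r₁ r₂ : Site (d + 1) → ℝ}
    (hE₁ : ∀ u : Site (d + 1), HasSum (fun u' : Site (d + 1) => ∑' yw : Site (d + 1) × Site (d + 1),
      comp (comp (dM (unitK sf sm (KInvStep (d := d) Lc j)) Lc S M κ u) (unitK sf sm (KInvStep (d := d) Lc j)))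
        (dM (unitK sf sm (KInvStep (d := d) Lc j)) Lc S M κ' u') yw.1 yw.2 (Sum.inl α) (Sum.inl β)) (e₁ u))
    (hE₂ : ∀ u : Site (d + 1), HasSum (fun u' : Site (d + 1) => ∑' yw : Site (d + 1) × Site (d + 1),
      comp (comp (dM (unitK sf sm (KInvStep (d := d) Lc j)) Lc S M κ' u') (unitK sf sm (KInvStep (d := d) Lc j)))
        (dM (unitK sf sm (KInvStep (d := d) Lc j)) Lc S M κ u) yw.1 yw.2 (Sum.inl α) (Sum.inl β)) (e₂ u))
    (hR₁ : ∀ u : Site (d + 1), HasSum (fun u' : Site (d + 1) => ∑' yw : Site (d + 1) × Site (d + 1),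
      dM (K2OfK (unitK sf sm (KInvStep (d := d) Lc j)) Lc S M κ' u') Lc S M κ u yw.1 yw.2 (Sum.inl α) (Sum.inl β)) (r₁ u))
    (hR₂ : ∀ u : Site (d + 1), HasSum (fun u' : Site (d + 1) => ∑' yw : Site (d + 1) × Site (d + 1),
      dM (K2OfK (unitK sf sm (KInvStep (d := d) Lc j)) Lc S M κ u) Lc S M κ' u' yw.1 yw.2 (Sum.inl α) (Sum.inl β)) (r₂ u)) :
    zmode P (fun κ u κ' u' => c • mmRead Lc (K3OfK (unitK sf sm (KInvStep (d := d) Lc j)) Lc S M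
        (W2SymOfK (unitK sf sm (KInvStep (d := d) Lc j)) Lc S M 0 M₂) κ u κ' u') + cB • vh₂S κ u κ' u') κ κ' (Sum.inl α) (Sum.inl β)
      = c * (-((sf * sm * ((((Lc ^ (j + 1) : ℕ) : ℝ)) ^ (d + 1 + 1))⁻¹) ^ 2) *
          ∑ r ∈ box (d + 1) P, (e₁ (toSite r) + e₂ (toSite r) - (r₁ (toSite r) + r₂ (toSite r)) / 2)) := by
  have h0 : ∀ u u' x z, (c • mmRead Lc (K3OfK (unitK sf sm (KInvStep (d := d) Lc j)) Lc S M
        (W2SymOfK (unitK sf sm (KInvStep (d := d) Lc j)) Lc S M 0 M₂) κ u κ' u') + cB • vh₂S κ u κ' u') x z (Sum.inl α) (Sum.inl β)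
      = c * mmRead Lc (K3OfK (unitK sf sm (KInvStep (d := d) Lc j)) Lc S M
        (W2SymOfK (unitK sf sm (KInvStep (d := d) Lc j)) Lc S M 0 M₂) κ u κ' u') x z (Sum.inl α) (Sum.inl β) := by
    intro u u' x z
    simp only [Pi.add_apply, Pi.smul_apply, smul_eq_mul, hBff, mul_zero, add_zero]
  unfold zmode
  rw [Finset.mul_sum, Finset.mul_sum]
  refine Finset.sum_congr rfl fun r _ => ?_
  simp_rw [h0, tsum_mul_left]
  rw [inner_value_unitKStep_eq sf sm j hS hδs hM hδM hM₂ hδ₂ hM₂t κ (toSite r) κ' α β (hE₁ _) (hE₂ _) (hR₁ _) (hR₂ _)]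

end Cell

/-! ## §4 The symmetrised cell charge (F2a-comb's currency): ONE scalar cell identity suffices; the comb-slot instance -/

section Sym

variable {Lc : ℕ} [NeZero Lc] (sf sm : ℝ) (j : ℕ)
  {S M : Fin (d + 1) → Site (d + 1) → MKer (d + 1) (Fib d)} {Cs δs CM δM : ℝ}
  {M₂ : Fin (d + 1) → Site (d + 1) → Fin (d + 1) → Site (d + 1) → MKer (d + 1) (Fib d)} {C₂ δ₂ : ℝ}

/-- NOT IN PRINT; OUR BOOKKEEPING ([folklore]; §3 `zmode_bracket_eq` at both index orders at the comb-slot reference tower's literal level-`j` data; shapes BY NAME: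
an2's `locStencil_SpureRecAt` ∕ `vertexFamily_M1At` under `locStencil_unitS` ∕ `vertexFamily_unitM`, an1's `hmix_an1` ∕ `hmixt_an1` ∕ `mixFFAt_inl_inr` ∕ `mixFFAt_inr`
through leaf-07's `locStencilFM_unitM₂_M2Of` and `unitM₂_translate ∘ M2Of_translate`).  **F2a-comb AT LEVEL `j`, CHARGE CONJUNCT, FROM ONE SYMMETRISED CELL CHANNEL
IDENTITY**: for every box root `r`, every `cE cVH cΛ`, every scalar `c` (the tower's `cE₂·Lc^{2(d+1)}`), every `cB` and border `vh₂S` with NO ff entries, if the four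
channel bond series of `(unitS_j (SpureRecAt … j), unitM_j (M1At … j))` through `K♮_j` have sums `e₁ e₂ r₁ r₂` and the symmetrised cell identity `hcell` holds at
`(κ, κ′)` for the period `Lc`, then the SYMMETRISED `Lc`-cell charge of `b^B_j` vanishes at `(κ, κ′, inl α, inl β)` — the second conjunct of the `hZ` binder of
`T2UndressedCombShapeEnd.t2Shape_undressedComb_three_of_F2a` at level `j` (there `d = 3`).  The cell identity is the HYPOTHESIS; its supplier is NOT in this file. -/
theorem zmodeSym_comb_bracket_eq_zero_of_cell (hLc : 1 ≤ Lc) {r : Fin (d + 1) → ℕ} (hr : r ∈ box (d + 1) Lc) (cE cVH cΛ c cB : ℝ)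
    {vh₂S : Tab d} (hBff : ∀ κ u κ' u' x z (α β : Fin (d + 1)), vh₂S κ u κ' u' x z (Sum.inl α) (Sum.inl β) = 0)
    (α β : Fin (d + 1)) {e₁ e₂ r₁ r₂ : Fin (d + 1) → Site (d + 1) → Fin (d + 1) → ℝ}
    (hE₁ : ∀ (κ : Fin (d + 1)) (u : Site (d + 1)) (κ' : Fin (d + 1)), HasSum (fun u' : Site (d + 1) => ∑' yw : Site (d + 1) × Site (d + 1),
      comp (comp (dM (unitK (sfStep Lc j) (smStep d Lc j) (KInvStep (d := d) Lc j)) Lc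
          (unitS (sfStep Lc j) (smStep d Lc j) (SpureRecAt d Lc (toSite r) cE cVH cΛ j)) (unitM (sfStep Lc j) (smStep d Lc j) (M1At d Lc (toSite r) cΛ j)) κ u)
        (unitK (sfStep Lc j) (smStep d Lc j) (KInvStep (d := d) Lc j)))
        (dM (unitK (sfStep Lc j) (smStep d Lc j) (KInvStep (d := d) Lc j)) Lc
          (unitS (sfStep Lc j) (smStep d Lc j) (SpureRecAt d Lc (toSite r) cE cVH cΛ j)) (unitM (sfStep Lc j) (smStep d Lc j) (M1At d Lc (toSite r) cΛ j)) κ' u')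
        yw.1 yw.2 (Sum.inl α) (Sum.inl β)) (e₁ κ u κ'))
    (hE₂ : ∀ (κ : Fin (d + 1)) (u : Site (d + 1)) (κ' : Fin (d + 1)), HasSum (fun u' : Site (d + 1) => ∑' yw : Site (d + 1) × Site (d + 1),
      comp (comp (dM (unitK (sfStep Lc j) (smStep d Lc j) (KInvStep (d := d) Lc j)) Lc
          (unitS (sfStep Lc j) (smStep d Lc j) (SpureRecAt d Lc (toSite r) cE cVH cΛ j)) (unitM (sfStep Lc j) (smStep d Lc j) (M1At d Lc (toSite r) cΛ j)) κ' u')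
        (unitK (sfStep Lc j) (smStep d Lc j) (KInvStep (d := d) Lc j)))
        (dM (unitK (sfStep Lc j) (smStep d Lc j) (KInvStep (d := d) Lc j)) Lc
          (unitS (sfStep Lc j) (smStep d Lc j) (SpureRecAt d Lc (toSite r) cE cVH cΛ j)) (unitM (sfStep Lc j) (smStep d Lc j) (M1At d Lc (toSite r) cΛ j)) κ u)
        yw.1 yw.2 (Sum.inl α) (Sum.inl β)) (e₂ κ u κ'))
    (hR₁ : ∀ (κ : Fin (d + 1)) (u : Site (d + 1)) (κ' : Fin (d + 1)), HasSum (fun u' : Site (d + 1) => ∑' yw : Site (d + 1) × Site (d + 1),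
      dM (K2OfK (unitK (sfStep Lc j) (smStep d Lc j) (KInvStep (d := d) Lc j)) Lc
          (unitS (sfStep Lc j) (smStep d Lc j) (SpureRecAt d Lc (toSite r) cE cVH cΛ j)) (unitM (sfStep Lc j) (smStep d Lc j) (M1At d Lc (toSite r) cΛ j)) κ' u') Lc
        (unitS (sfStep Lc j) (smStep d Lc j) (SpureRecAt d Lc (toSite r) cE cVH cΛ j)) (unitM (sfStep Lc j) (smStep d Lc j) (M1At d Lc (toSite r) cΛ j)) κ u
        yw.1 yw.2 (Sum.inl α) (Sum.inl β)) (r₁ κ u κ'))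
    (hR₂ : ∀ (κ : Fin (d + 1)) (u : Site (d + 1)) (κ' : Fin (d + 1)), HasSum (fun u' : Site (d + 1) => ∑' yw : Site (d + 1) × Site (d + 1),
      dM (K2OfK (unitK (sfStep Lc j) (smStep d Lc j) (KInvStep (d := d) Lc j)) Lc
          (unitS (sfStep Lc j) (smStep d Lc j) (SpureRecAt d Lc (toSite r) cE cVH cΛ j)) (unitM (sfStep Lc j) (smStep d Lc j) (M1At d Lc (toSite r) cΛ j)) κ u) Lc
        (unitS (sfStep Lc j) (smStep d Lc j) (SpureRecAt d Lc (toSite r) cE cVH cΛ j)) (unitM (sfStep Lc j) (smStep d Lc j) (M1At d Lc (toSite r) cΛ j)) κ' u'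
        yw.1 yw.2 (Sum.inl α) (Sum.inl β)) (r₂ κ u κ'))
    (κ κ' : Fin (d + 1))
    (hcell : ∑ ρ' ∈ box (d + 1) Lc, (e₁ κ (toSite ρ') κ' + e₂ κ (toSite ρ') κ' - (r₁ κ (toSite ρ') κ' + r₂ κ (toSite ρ') κ') / 2)
      + ∑ ρ' ∈ box (d + 1) Lc, (e₁ κ' (toSite ρ') κ + e₂ κ' (toSite ρ') κ - (r₁ κ' (toSite ρ') κ + r₂ κ' (toSite ρ') κ) / 2) = 0) :
    zmode Lc (fun κ u κ' u' => c • mmRead Lc (K3OfK (unitK (sfStep Lc j) (smStep d Lc j) (KInvStep (d := d) Lc j)) Lc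
          (unitS (sfStep Lc j) (smStep d Lc j) (SpureRecAt d Lc (toSite r) cE cVH cΛ j)) (unitM (sfStep Lc j) (smStep d Lc j) (M1At d Lc (toSite r) cΛ j))
          (W2SymOfK (unitK (sfStep Lc j) (smStep d Lc j) (KInvStep (d := d) Lc j)) Lc
            (unitS (sfStep Lc j) (smStep d Lc j) (SpureRecAt d Lc (toSite r) cE cVH cΛ j)) (unitM (sfStep Lc j) (smStep d Lc j) (M1At d Lc (toSite r) cΛ j)) 0
            (unitM₂ (sfStep Lc j) (smStep d Lc j) (M2Of d Lc (mixFFAt (toSite r) Lc) j))) κ u κ' u') + cB • vh₂S κ u κ' u') κ κ' (Sum.inl α) (Sum.inl β)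
      + zmode Lc (fun κ u κ' u' => c • mmRead Lc (K3OfK (unitK (sfStep Lc j) (smStep d Lc j) (KInvStep (d := d) Lc j)) Lc
          (unitS (sfStep Lc j) (smStep d Lc j) (SpureRecAt d Lc (toSite r) cE cVH cΛ j)) (unitM (sfStep Lc j) (smStep d Lc j) (M1At d Lc (toSite r) cΛ j))
          (W2SymOfK (unitK (sfStep Lc j) (smStep d Lc j) (KInvStep (d := d) Lc j)) Lc
            (unitS (sfStep Lc j) (smStep d Lc j) (SpureRecAt d Lc (toSite r) cE cVH cΛ j)) (unitM (sfStep Lc j) (smStep d Lc j) (M1At d Lc (toSite r) cΛ j)) 0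
            (unitM₂ (sfStep Lc j) (smStep d Lc j) (M2Of d Lc (mixFFAt (toSite r) Lc) j))) κ u κ' u') + cB • vh₂S κ u κ' u') κ' κ (Sum.inl α) (Sum.inl β) = 0 := by
  -- the level-`j` shape data of the recursive tables, BY NAME
  obtain ⟨Cs, δs, hδs, hS0⟩ := locStencil_SpureRecAt (d := d) (Lc := Lc) hLc hr cE cVH cΛ j
  have hS := locStencil_unitS (sf := sfStep Lc j) (sm := smStep d Lc j) hS0
  have hM := vertexFamily_unitM (Lc := Lc) (vertexFamily_M1At (d := d) (Lc := Lc) hLc hr cΛ j zero_le_one) (sfStep Lc j) (smStep d Lc j)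
  obtain ⟨C₂, δ₂, hδ₂, hmix⟩ := hmix_an1 (d := d) (Lc := Lc) (r := r) hLc hr
  have hM₂ := locStencilFM_unitM₂_M2Of (Lc := Lc) hmix
    (fun κ u ρ' w x z α μ' => mixFFAt_inl_inr (toSite r) Lc κ u ρ' w x z α μ') (fun κ u ρ' w x z μ' b => mixFFAt_inr (toSite r) Lc κ u ρ' w x z μ' b) j
  have hM₂t : ∀ (κ : Fin (d + 1)) (u : Site (d + 1)) (ρ' : Fin (d + 1)) (w t : Site (d + 1)),
      unitM₂ (sfStep Lc j) (smStep d Lc j) (M2Of d Lc (mixFFAt (toSite r) Lc) j) κ (u + (Lc : ℤ) • t) ρ' (w + t)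
        = shiftK (-((Lc : ℤ) • t)) (unitM₂ (sfStep Lc j) (smStep d Lc j) (M2Of d Lc (mixFFAt (toSite r) Lc) j) κ u ρ' w) :=
    fun κ u ρ' w t => unitM₂_translate (Lc := Lc) (sfStep Lc j) (smStep d Lc j)
      (fun κ u ρ' w t => M2Of_translate (hmixt_an1 (toSite r)) j κ u ρ' w t) κ u ρ' w t
  rw [zmode_bracket_eq (sfStep Lc j) (smStep d Lc j) j Lc c cB hBff hS hδs hM one_pos hM₂ hδ₂ hM₂t κ κ' α β
      (hE₁ κ · κ') (hE₂ κ · κ') (hR₁ κ · κ') (hR₂ κ · κ'),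
    zmode_bracket_eq (sfStep Lc j) (smStep d Lc j) j Lc c cB hBff hS hδs hM one_pos hM₂ hδ₂ hM₂t κ' κ α β
      (hE₁ κ' · κ) (hE₂ κ' · κ) (hR₁ κ' · κ) (hR₂ κ' · κ),
    ← mul_add, ← mul_add, hcell, mul_zero, mul_zero]

end Sym

end Summit.QuantumFields.BalabanUV.Beta.GAN24.SourceBracketChannelCharge

end
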